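import Summits.BirchSwinnertonDyer.BirchSwinnertonDyer.Theorems.ManinLocalTwoThreeTowerDescent
import Summits.BirchSwinnertonDyer.Rank1Residual.ManinAdditive.DegeneracyLoopLaws

/-!
# The CONVERSE of the unit-twist laws: a unit even twisted value at ANY conductor prime to `N` forces the plus index to be
# prime to `p` (the Ash–Stevens lower bound `v_p(Λ⁺(χ)) ≥ v_p(d)`, MEMO-an §71.1; es MEMO-es §36.5 «Thm R(ii)»)

Summit `BirchSwinnertonDyer`, route `ManinLocalTwoThree` (cell bsd-f2-manin), cruxes C3 `ManinPrimeToThreeAtNine` (stmt-BirchSwinnertonDyer-22968)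
/ C2 `ManinOddAtFour` (stmt-…-22967).  The cell's unit-twist laws (E-es-66/66₂, E-es-87♭, E-an-135 `TowerUnitTwist`) all carry the
hypothesis `PlusIndexPrimeTo p f` (`p ∤ d`, `d = [Λ_f⁺ : Λ₁(f)⁺]`).  This file proves that the hypothesis is NECESSARY:

* `plusIndexPrimeTo_of_evenUnitTwist` — for a rational newform `f ∈ S₂(Γ₀(N))`, a modulus `m > 2` prime to `N`, an EVEN Dirichlet character
  `χ ≠ 1` mod `m` and `r` with `Σ_a χ(a){∞, a/m}_f = r·Ω⁺_f` such that `s·r/p` is never an algebraic integer (`p ∤ s`):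
  `PlusIndexPrimeTo p f`.

PROOF (§71.1 CONSEQUENCE).  If the plus index is divisible by `p`, every `Γ₁`-period has plus part in `pℤ·Ω⁺`; the cusps `a/m`, `a` a unit,
are `Γ₁(N)`-equivalent (`modularSymbol_sub_mem_periodLatticeGamma1`), so `F(a) := ({∞,a/m} − {∞,0} + conj)/Ω⁺` is constant mod `p` on the
units; as `Σ_a χ(a) = 0`, `F̂(χ) = p·Σ_a χ(a) g(a)` with `g` integer-valued and even, and the latter sum is TWICE an algebraic integer (pair
`a ↔ −a`; no unit is its own negative for `m > 2`); with `2·S_χ = Ω⁺·F̂(χ)` this gives `r = p·G`, `G` integral — so `1·r/p` is integral.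

* `sum_eq_two_mul_sum_filter_of_neg` — the pairing lemma: an even function on `ℤ/m` vanishing at the elements with `a = −a` sums to twice
  its sum over `{a : a.val < (−a).val}`.

HONEST FRAMING: an f-level statement about period lattices; nothing about Manin's conjecture or BSD is asserted.  No definitions, no named
facts, no sorry.
-/

set_option linter.dupNamespace false
set_option autoImplicit false

noncomputable section

open scoped Classical MatrixGroups ModularForm ComplexConjugate

open CongruenceSubgroup Complex Literature.NumberTheory.EllipticCurves
  Literature.NumberTheory.EllipticCurves.ModularForms
  Summit.BirchSwinnertonDyer.Rank1Residual.ManinAdditive.Gamma1Lattice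
  Summit.BirchSwinnertonDyer.Rank1Residual.ManinAdditive.KatoCurve

namespace Summit.BirchSwinnertonDyer.BirchSwinnertonDyer.Theorems.ManinLocalTwoThree

/-! ### §1 The pairing lemma on `ℤ/m` -/

/-- **Pairing `a ↔ −a`.**  If `h : ℤ/m → ℂ` is even (`h(−a) = h(a)`) and vanishes at every `a` with `a = −a`, then
`Σ_a h(a) = 2 · Σ_{a : a.val < (−a).val} h(a)`. [folklore] -/
theorem sum_eq_two_mul_sum_filter_of_neg {m : ℕ} [NeZero m] (h : ZMod m → ℂ) (heven : ∀ a, h (-a) = h a)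
    (hfix : ∀ a : ZMod m, a = -a → h a = 0) :
    ∑ a : ZMod m, h a = 2 * ∑ a ∈ Finset.univ.filter (fun a : ZMod m ↦ a.val < (-a).val), h a := by
  have hsplit : ∀ a : ZMod m, h a = (if a.val < (-a).val then h a else 0) + (if (-a).val < a.val then h a else 0) := by
    intro a
    rcases lt_trichotomy a.val (-a).val with hlt | heq | hgt
    · rw [if_pos hlt, if_neg (not_lt.mpr hlt.le), add_zero]
    · rw [if_neg (by omega), if_neg (by omega), add_zero]
      exact hfix a (ZMod.val_injective m heq)
    · rw [if_neg (not_lt.mpr hgt.le), if_pos hgt, zero_add]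
  have h2 : ∑ a : ZMod m, (if (-a).val < a.val then h a else 0) = ∑ a : ZMod m, (if a.val < (-a).val then h a else 0) := by
    refine Fintype.sum_equiv (Equiv.neg (ZMod m)) _ _ fun a ↦ ?_
    rw [Equiv.neg_apply, neg_neg, heven]
  rw [Finset.sum_congr rfl (fun a _ ↦ hsplit a), Finset.sum_add_distrib, h2, ← two_mul, Finset.sum_filter]

/-- A unit of `ℤ/m`, `m > 2`, is not its own negative. [folklore] -/
theorem ne_neg_of_isUnit {m : ℕ} [NeZero m] (hm : 2 < m) {a : ZMod m} (ha : IsUnit a) : a ≠ -a := by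
  intro h
  have h2 : (2 : ZMod m) * a = 0 := by rw [two_mul]; nth_rewrite 2 [h]; exact add_neg_cancel a
  obtain ⟨u, rfl⟩ := ha
  have h2' : (2 : ZMod m) = 0 := by
    have := congrArg (· * (↑u⁻¹ : ZMod m)) h2
    simpa [mul_assoc, Units.mul_inv] using this
  have : ((2 : ℕ) : ZMod m) = 0 := by exact_mod_cast h2'
  rw [ZMod.natCast_eq_zero_iff] at this
  exact absurd (Nat.le_of_dvd two_pos this) (by omega)

/-! ### §2 The `ℤ/m` bookkeeping at an arbitrary modulus (private; cf. `…TowerDescent`, `…DegeneracyUnitTwistSignMove`) -/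

variable {N : ℕ} [NeZero N] (f : CuspForm (Gamma0 N) 2)

section Level

variable {m : ℕ} [NeZero m]

omit [NeZero N] [NeZero m] in
/-- `y_0 = 0` for `y_a := {∞, a/m}_f − {∞, 0}_f`. -/
private theorem yS_zero : modularSymbol f (((0 : ZMod m).val : ℚ) / m) - modularSymbol f 0 = 0 := by
  simp [ZMod.val_zero]

omit [NeZero m] in
/-- `y_a ∈ Λ_f` for every `a : ℤ/m`, `m` prime to `N`. -/
private theorem yS_mem_periodLattice (hNm : IsCoprime (N : ℤ) m) (a : ZMod m) :
    modularSymbol f ((a.val : ℚ) / m) - modularSymbol f 0 ∈ periodLattice f := by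
  have e : ((a.val : ℤ) : ℚ) / ((m : ℤ) : ℚ) = (a.val : ℚ) / m := by push_cast; rfl
  rw [← e]
  exact modularSymbol_intCast_div_sub_zero_mem_periodLattice f hNm _ dvd_rfl

/-- `y_{−a} = conj y_a` for `f` with real coefficients. -/
private theorem yS_neg (hreal : ∀ n, (cuspCoeff f n).im = 0) (a : ZMod m) :
    modularSymbol f (((-a).val : ℚ) / m) - modularSymbol f 0 =
      conj (modularSymbol f ((a.val : ℚ) / m) - modularSymbol f 0) := by
  have h0 : conj (modularSymbol f 0) = modularSymbol f 0 := by
    have := modularSymbol_neg_eq_conj_holds f hreal 0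
    rw [neg_zero] at this
    exact this.symm
  by_cases ha : a = 0
  · rw [ha, neg_zero, yS_zero, map_zero]
  · have hval : (-a).val = m - a.val := by rw [ZMod.neg_val, if_neg ha]
    have hlt : a.val ≤ m := (ZMod.val_lt a).le
    have hmQ : (m : ℚ) ≠ 0 := by exact_mod_cast (NeZero.ne m)
    have e : (((-a).val : ℚ) / m) = -((a.val : ℚ) / m) + ((1 : ℤ) : ℚ) := by
      rw [hval, Nat.cast_sub hlt]
      field_simp
      push_cast
      ring
    rw [e, modularSymbol_add_intCast_holds f, modularSymbol_neg_eq_conj_holds f hreal, map_sub, h0]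

/-- Half-sum identity at any modulus: `2 · S_χ = Σ_a χ(a)·(y_a + ȳ_a)` for even `χ ≠ 1` and real `f`. -/
private theorem two_mul_S_eq (hreal : ∀ n, (cuspCoeff f n).im = 0) {χ : DirichletCharacter ℂ m}
    (hχ : χ ≠ 1) (hev : χ.Even) :
    2 * twistedSymbolSum f χ = ∑ a : ZMod m, χ a * ((modularSymbol f ((a.val : ℚ) / m) - modularSymbol f 0) +
      conj (modularSymbol f ((a.val : ℚ) / m) - modularSymbol f 0)) := by
  have hS : twistedSymbolSum f χ = ∑ a : ZMod m, χ a * (modularSymbol f ((a.val : ℚ) / m) - modularSymbol f 0) := by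
    have : ∑ a : ZMod m, χ a * (modularSymbol f ((a.val : ℚ) / m) - modularSymbol f 0) =
        ∑ a : ZMod m, χ a * modularSymbol f ((a.val : ℚ) / m) - (∑ a : ZMod m, χ a) * modularSymbol f 0 := by
      simp only [mul_sub, Finset.sum_sub_distrib, Finset.sum_mul]
    rw [this, χ.sum_eq_zero_of_ne_one hχ, zero_mul, sub_zero]
    rfl
  have hS' : twistedSymbolSum f χ =
      ∑ a : ZMod m, χ a * conj (modularSymbol f ((a.val : ℚ) / m) - modularSymbol f 0) := by
    rw [hS]
    refine Fintype.sum_equiv (Equiv.neg (ZMod m)) _ _ fun a ↦ ?_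
    rw [Equiv.neg_apply, hev.eval_neg, yS_neg f hreal, Complex.conj_conj]
  rw [two_mul]
  nth_rewrite 1 [hS]
  rw [hS', ← Finset.sum_add_distrib]
  refine Finset.sum_congr rfl fun a _ ↦ ?_
  ring

end Level

/-! ### §3 The converse: a unit even twisted value forces `PlusIndexPrimeTo p f` -/

variable {f}

/-- If the plus index is NOT prime to `p`, every `Γ₁(N)`-period has plus part in `pℤ · Ω⁺_f`. -/
theorem forall_plus_dvd_of_not_plusIndexPrimeTo (hf : IsNewform0 f) (hQ : coeffField f = ⊥) {p : ℕ}
    (hd : ¬ PlusIndexPrimeTo p f) :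
    ∀ y ∈ periodLatticeGamma1 f, ∀ j : ℤ, y + conj y = (j : ℂ) * (plusPeriod f : ℂ) → (p : ℤ) ∣ j := by
  obtain ⟨hpos, -⟩ := plusPeriod_pos_and_realPeriods_eq isZLattice_periodLattice_holds hf hQ
  have hΩ : (plusPeriod f : ℂ) ≠ 0 := by exact_mod_cast hpos.ne'
  by_contra hcon
  push Not at hcon
  obtain ⟨y₁, hy₁, j₁, hj₁, hpj₁⟩ := hcon
  apply hd
  intro x hx
  obtain ⟨i, hi⟩ := exists_int_add_conj_eq_mul_plusPeriod hf hQ hx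
  -- `y := (sign j₁ · i) • y₁`, `k := |j₁|`
  refine ⟨((Int.sign j₁ * i : ℤ) : ℂ) * y₁, ?_, j₁.natAbs, ?_, ?_⟩
  · have : ((Int.sign j₁ * i : ℤ) : ℂ) * y₁ = (Int.sign j₁ * i) • y₁ := by rw [zsmul_eq_mul]
    rw [this]
    exact AddSubgroup.zsmul_mem _ hy₁ _
  · exact fun h ↦ hpj₁ (Int.natCast_dvd.mpr h)
  · rw [hi, map_mul, map_intCast, ← mul_add, hj₁]
    have hn : ((j₁.natAbs : ℕ) : ℂ) = ((Int.sign j₁ : ℤ) : ℂ) * (j₁ : ℂ) := by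
      rw [Nat.cast_natAbs, ← Int.sign_mul_self_eq_abs]; push_cast; ring
    rw [hn]; push_cast; ring

/-- **The plus index is NECESSARY for a unit even twist** (Ash–Stevens lower bound, MEMO-an §71.1; es «Thm R(ii)»).  For a rational newform
`f ∈ S₂(Γ₀(N))`, a modulus `m > 2` prime to `N`, an even Dirichlet character `χ ≠ 1` mod `m` and `r` with
`Σ_a χ(a){∞, a/m}_f = r·Ω⁺_f`: if `s·r/p` is not an algebraic integer for any `s` prime to `p`, then `PlusIndexPrimeTo p f`. -/
theorem plusIndexPrimeTo_of_evenUnitTwist (hf : IsNewform0 f) (hQ : coeffField f = ⊥) {p : ℕ} (hp : p.Prime)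
    {m : ℕ} [NeZero m] (hm : 2 < m) (hNm : IsCoprime (N : ℤ) m) {χ : DirichletCharacter ℂ m} (hχ1 : χ ≠ 1) (hev : χ.Even)
    {r : ℂ} (hr : twistedSymbolSum f χ = r * (plusPeriod f : ℂ))
    (hunit : ∀ s : ℕ, ¬ p ∣ s → ¬ IsIntegral ℤ ((s : ℂ) * r / p)) :
    PlusIndexPrimeTo p f := by
  by_contra hd
  obtain ⟨hpos, -⟩ := plusPeriod_pos_and_realPeriods_eq isZLattice_periodLattice_holds hf hQ
  have hΩ : (plusPeriod f : ℂ) ≠ 0 := by exact_mod_cast hpos.ne'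
  have hreal : ∀ n, (cuspCoeff f n).im = 0 := cuspCoeff_im_eq_zero_of_coeffField_eq_bot hQ
  have hall := forall_plus_dvd_of_not_plusIndexPrimeTo hf hQ hd
  have hm0 : (m : ℤ) ≠ 0 := by exact_mod_cast (NeZero.ne m)
  -- the integer-valued even function `F`
  have hF : ∀ a : ZMod m, ∃ k : ℤ, (modularSymbol f ((a.val : ℚ) / m) - modularSymbol f 0) +
      conj (modularSymbol f ((a.val : ℚ) / m) - modularSymbol f 0) = (k : ℂ) * (plusPeriod f : ℂ) :=
    fun a ↦ exists_int_add_conj_eq_mul_plusPeriod hf hQ (yS_mem_periodLattice f hNm a)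
  choose F hF using hF
  have hFeven : ∀ a : ZMod m, F (-a) = F a := by
    intro a
    have h1 := hF (-a)
    rw [yS_neg f hreal, Complex.conj_conj, add_comm, hF a] at h1
    exact_mod_cast (mul_right_cancel₀ hΩ h1).symm
  -- `F` is constant mod `p` on the units: `y_a − y_1 ∈ Λ₁(f)`
  have hcong : ∀ a : ZMod m, IsUnit a → (p : ℤ) ∣ F a - F 1 := by
    intro a ha
    have hcop : IsCoprime (a.val : ℤ) m := by
      have h := (ZMod.isUnit_iff_coprime a.val m).mp (by rwa [ZMod.natCast_zmod_val])
      exact Nat.isCoprime_iff_coprime.mpr h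
    have h1cop : IsCoprime ((1 : ZMod m).val : ℤ) m := by
      rw [ZMod.val_one'' (by omega : m ≠ 1)]; exact isCoprime_one_left
    have hmem := modularSymbol_sub_mem_periodLatticeGamma1 f hm0 hcop h1cop hNm
    have e : modularSymbol f (((a.val : ℤ) : ℚ) / (m : ℤ)) - modularSymbol f ((((1 : ZMod m).val : ℤ) : ℚ) / (m : ℤ)) =
        (modularSymbol f ((a.val : ℚ) / m) - modularSymbol f 0) -
          (modularSymbol f (((1 : ZMod m).val : ℚ) / m) - modularSymbol f 0) := by push_cast; ring
    rw [e] at hmem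
    refine hall _ hmem (F a - F 1) ?_
    rw [map_sub, Int.cast_sub, sub_mul, ← hF, ← hF]
    ring
  -- `g(a) := (F a − F 1)/p` (exact on units), even
  set g : ZMod m → ℤ := fun a ↦ (F a - F 1) / p with hg
  have hgF : ∀ a : ZMod m, IsUnit a → F a - F 1 = p * g a := fun a ha ↦ (Int.mul_ediv_cancel' (hcong a ha)).symm
  have hgeven : ∀ a, g (-a) = g a := fun a ↦ by simp only [hg, hFeven]
  -- `F̂(χ) = p · Σ_a χ(a) g(a)`
  have hhat : ∑ a : ZMod m, χ a * (F a : ℂ) = (p : ℂ) * ∑ a : ZMod m, χ a * (g a : ℂ) := by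
    have h1 : ∑ a : ZMod m, χ a * (F a : ℂ) = ∑ a : ZMod m, χ a * ((F a - F 1 : ℤ) : ℂ) := by
      have : ∑ a : ZMod m, χ a * ((F a - F 1 : ℤ) : ℂ) =
          ∑ a : ZMod m, χ a * (F a : ℂ) - (∑ a : ZMod m, χ a) * (F 1 : ℂ) := by
        simp only [Int.cast_sub, mul_sub, Finset.sum_sub_distrib, Finset.sum_mul]
      rw [this, χ.sum_eq_zero_of_ne_one hχ1, zero_mul, sub_zero]
    rw [h1, Finset.mul_sum]
    refine Finset.sum_congr rfl fun a _ ↦ ?_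
    by_cases ha : IsUnit a
    · rw [hgF a ha]; push_cast; ring
    · rw [χ.map_nonunit ha, zero_mul, zero_mul, mul_zero]
  -- the latter sum is twice an algebraic integer
  have hpair := sum_eq_two_mul_sum_filter_of_neg (fun a ↦ χ a * (g a : ℂ))
    (fun a ↦ by simp only [hev.eval_neg, hgeven])
    (fun a ha ↦ by
      by_cases hu : IsUnit a
      · exact absurd ha (ne_neg_of_isUnit hm hu)
      · rw [χ.map_nonunit hu, zero_mul])
  set G : ℂ := ∑ a ∈ Finset.univ.filter (fun a : ZMod m ↦ a.val < (-a).val), χ a * (g a : ℂ) with hG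
  have hGI : IsIntegral ℤ G := IsIntegral.sum _ fun a _ ↦
    (DirichletCharacter.isIntegral_apply χ a).mul (isIntegral_algebraMap (R := ℤ) (x := g a))
  -- `2 S_χ = Ω⁺ F̂(χ) = 2 p G Ω⁺`, so `r = p G`
  have h2 := two_mul_S_eq f hreal hχ1 hev
  simp_rw [hF, ← mul_assoc, ← Finset.sum_mul] at h2
  rw [hhat, hpair, hr] at h2
  have hrG : r = (p : ℂ) * G := by
    have : (2 : ℂ) * r * (plusPeriod f : ℂ) = 2 * ((p : ℂ) * G) * (plusPeriod f : ℂ) := by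
      rw [mul_assoc, h2]; ring
    exact mul_left_cancel₀ two_ne_zero (mul_right_cancel₀ hΩ this)
  -- `1 · r / p = G` is integral: contradiction
  refine hunit 1 (fun h ↦ hp.one_lt.ne' (Nat.dvd_one.mp h)) ?_
  have hp0 : (p : ℂ) ≠ 0 := by exact_mod_cast hp.ne_zero
  rw [Nat.cast_one, one_mul, hrG, mul_div_cancel_left₀ G hp0]
  exact hGI

end Summit.BirchSwinnertonDyer.BirchSwinnertonDyer.Theorems.ManinLocalTwoThree

end
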